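import Summits.Ventures.Crystal3D.Theorems.StickyWulffConstantPolycrystalWulffBoundRungSingleAxisTexture

/-!
# `PolycrystalWulffBound`, line `PolyDensity`: free form of the single-axis texture rung and the
# three-direction lemma (crux `stmt-Ventures-19482`)

Route `StickyWulffConstant` of the venture `Summits/Ventures/Crystal3D`, second prover lane (poly-p2,
gen 10).  (1) `three_dir_abs_sum_le`: for an orthonormal triple `(u, w, m₀)` and the three horizontal
`⟨112⟩` directions `w, w₂ = (√3/2)u − w/2, w₃ = −(√3/2)u − w/2`, every unit `ν` satisfies
`|⟪w,ν⟫| + |⟪w₂,ν⟫| + |⟪w₃,ν⟫| ≤ 2·√(1 − ⟪ν,m₀⟫²)` (Bessel + a planar estimate; tight at the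
`⟨112⟩` azimuths).  (2) `rung_singleAxis_texture_free`: the general single-axis rung in grain form for
ANY one `w` — `6·2^{1/3}(√2·Vol)^{2/3} ≤ Fr + (1/√6)·Σ_{τ f ≠ τ g} Σ_{a ∈ s f, b ∈ s g} |⟪w, ν_{ab}⟫|·facetArea`
(cell rung `rung_singleAxis_cells` + `freeEnergy_eq_merged_texture`).  Consumed by
`…RungSingleAxisCharge` (`c ≥ 4/(3√6)` ⇒ `≤ En`, no azimuth test).
WHAT THIS IS NOT: the law of record (`c₁ = ½`); the crux is not claimed.
-/

noncomputable section

open scoped BigOperators InnerProductSpace ENNReal Pointwise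
open MeasureTheory Filter Set

namespace Summit.Ventures.Crystal3D.Cruxes.PolycrystalWulffBound.PolyDensity

open Summit.Ventures.Crystal3D.Theorems
open Summit.Ventures.Crystal3D.Cruxes.TextureLiminf.TexShadow (per polytope facetArea supportFn E3
  PolytopeCalculus stub_polytopeCalculus)
open Literature.MathematicalPhysics.StatisticalMechanics (fccStacking barlowStacking IsHaggSeq perimeter)

/-- **Three `⟨112⟩` directions see every wall**: for an orthonormal triple `(u, w, m₀)` and
`w₂ = (√3/2)u − w/2`, `w₃ = −(√3/2)u − w/2`, every unit `ν` has
`|⟪w,ν⟫| + |⟪w₂,ν⟫| + |⟪w₃,ν⟫| ≤ 2·√(1 − ⟪ν,m₀⟫²)` (equality at the `⟨112⟩` azimuths). -/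
theorem three_dir_abs_sum_le {u w m₀ w₂ w₃ : E3} (hu : ‖u‖ = 1) (hw : ‖w‖ = 1) (hm₀ : ‖m₀‖ = 1)
    (hum : ⟪u, m₀⟫_ℝ = 0) (hwm : ⟪w, m₀⟫_ℝ = 0) (hwu : ⟪w, u⟫_ℝ = 0)
    (hw₂ : w₂ = (Real.sqrt 3 / 2) • u - (1 / 2 : ℝ) • w) (hw₃ : w₃ = -(Real.sqrt 3 / 2) • u - (1 / 2 : ℝ) • w) :
    ∀ ν : E3, ‖ν‖ = 1 → |⟪w, ν⟫_ℝ| + |⟪w₂, ν⟫_ℝ| + |⟪w₃, ν⟫_ℝ| ≤ 2 * Real.sqrt (1 - ⟪ν, m₀⟫_ℝ ^ 2) := by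
  have h3 : Real.sqrt 3 ^ 2 = 3 := Real.sq_sqrt (by norm_num)
  have huw : ⟪u, w⟫_ℝ = 0 := by rw [real_inner_comm]; exact hwu
  have hvon : Orthonormal ℝ ![u, w, m₀] := by
    rw [orthonormal_iff_ite]
    have hmu : ⟪m₀, u⟫_ℝ = 0 := by rw [real_inner_comm]; exact hum
    have hmw : ⟪m₀, w⟫_ℝ = 0 := by rw [real_inner_comm]; exact hwm
    intro i j
    fin_cases i <;> fin_cases j <;> simp [hu, hw, hm₀, hum, hwm, hwu, hmu, hmw, huw]
  intro ν hν
  have ha2 : ⟪w₂, ν⟫_ℝ = Real.sqrt 3 / 2 * ⟪u, ν⟫_ℝ - 1 / 2 * ⟪w, ν⟫_ℝ := by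
    rw [hw₂, inner_sub_left, real_inner_smul_left, real_inner_smul_left]
  have ha3 : ⟪w₃, ν⟫_ℝ = -(Real.sqrt 3 / 2) * ⟪u, ν⟫_ℝ - 1 / 2 * ⟪w, ν⟫_ℝ := by
    rw [hw₃]
    simp only [inner_sub_left, inner_neg_left, real_inner_smul_left, neg_smul]
    ring
  -- Bessel: `⟪u,ν⟫² + ⟪w,ν⟫² + ⟪m₀,ν⟫² ≤ 1`
  have hbessel : ⟪u, ν⟫_ℝ ^ 2 + ⟪w, ν⟫_ℝ ^ 2 + ⟪m₀, ν⟫_ℝ ^ 2 ≤ 1 := by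
    have h := hvon.sum_inner_products_le (s := Finset.univ) (x := ν)
    rw [Fin.sum_univ_three, hν, one_pow] at h
    simpa only [Matrix.cons_val_zero, Matrix.cons_val_one, Matrix.head_cons, Matrix.cons_val_two,
      Matrix.tail_cons, Real.norm_eq_abs, sq_abs] using h
  have hm2 : ⟪ν, m₀⟫_ℝ ^ 2 = ⟪m₀, ν⟫_ℝ ^ 2 := by rw [real_inner_comm]
  -- the planar estimate `|a| + |p| + |q| ≤ 2 √(a² + b²)`
  generalize ⟪w, ν⟫_ℝ = a at ha2 ha3 hbessel ⊢
  generalize ⟪u, ν⟫_ℝ = b at ha2 ha3 hbessel ⊢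
  rw [ha2, ha3]
  have hab : a ^ 2 + b ^ 2 ≤ 1 - ⟪ν, m₀⟫_ℝ ^ 2 := by rw [hm2]; linarith
  have e1 : (Real.sqrt 3 / 2 * b - 1 / 2 * a) + (-(Real.sqrt 3 / 2) * b - 1 / 2 * a) = -a := by ring
  have e2 : (Real.sqrt 3 / 2 * b - 1 / 2 * a) - (-(Real.sqrt 3 / 2) * b - 1 / 2 * a) = Real.sqrt 3 * b := by
    ring
  generalize (Real.sqrt 3 / 2 * b - 1 / 2 * a) = p at e1 e2 ⊢
  generalize (-(Real.sqrt 3 / 2) * b - 1 / 2 * a) = q at e1 e2 ⊢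
  have hs3 : 0 ≤ Real.sqrt 3 := Real.sqrt_nonneg 3
  have hpq : |p| + |q| ≤ max (|a|) (Real.sqrt 3 * |b|) := by
    rcases le_total 0 p with hp0 | hp0 <;> rcases le_total 0 q with hq0 | hq0
    · rw [abs_of_nonneg hp0, abs_of_nonneg hq0]
      exact le_trans (by linarith only [e1, neg_le_abs a]) (le_max_left _ _)
    · rw [abs_of_nonneg hp0, abs_of_nonpos hq0]
      have hb' := mul_le_mul_of_nonneg_left (le_abs_self b) hs3
      exact le_trans (by linarith only [e2, hb']) (le_max_right _ _)
    · rw [abs_of_nonpos hp0, abs_of_nonneg hq0]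
      have hb' := mul_le_mul_of_nonneg_left (neg_le_abs b) hs3
      exact le_trans (by linarith only [e2, hb']) (le_max_right _ _)
    · rw [abs_of_nonpos hp0, abs_of_nonpos hq0]
      exact le_trans (by linarith only [e1, le_abs_self a]) (le_max_left _ _)
  have hs0 : 0 ≤ Real.sqrt (a ^ 2 + b ^ 2) := Real.sqrt_nonneg _
  have h1 : |a| ≤ Real.sqrt (a ^ 2 + b ^ 2) := Real.abs_le_sqrt (le_add_of_nonneg_right (sq_nonneg b))
  have h2 : |a| + Real.sqrt 3 * |b| ≤ 2 * Real.sqrt (a ^ 2 + b ^ 2) := by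
    have hsq : (|a| + Real.sqrt 3 * |b|) ^ 2 ≤ 4 * (a ^ 2 + b ^ 2) := by
      have e : 4 * (a ^ 2 + b ^ 2) = 4 * (|a| ^ 2 + |b| ^ 2) := by rw [sq_abs, sq_abs]
      rw [e]
      have h3a : Real.sqrt 3 ^ 2 * |a| ^ 2 = 3 * |a| ^ 2 := by rw [h3]
      have h3b : Real.sqrt 3 ^ 2 * |b| ^ 2 = 3 * |b| ^ 2 := by rw [h3]
      nlinarith only [sq_nonneg (Real.sqrt 3 * |a| - |b|), h3a, h3b]
    have h4 : Real.sqrt (4 * (a ^ 2 + b ^ 2)) = 2 * Real.sqrt (a ^ 2 + b ^ 2) := by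
      rw [Real.sqrt_mul (by norm_num), show (4 : ℝ) = 2 ^ 2 by norm_num,
        Real.sqrt_sq (by norm_num : (0:ℝ) ≤ 2)]
    have h5 := Real.abs_le_sqrt hsq
    rw [abs_of_nonneg (by positivity), h4] at h5
    exact h5
  have hsum : |a| + |p| + |q| ≤ 2 * Real.sqrt (a ^ 2 + b ^ 2) := by
    rcases le_total (|a|) (Real.sqrt 3 * |b|) with hc' | hc'
    · rw [max_eq_right hc'] at hpq; linarith only [hpq, h2]
    · rw [max_eq_left hc'] at hpq; linarith only [hpq, h1]
  calc |a| + |p| + |q| ≤ 2 * Real.sqrt (a ^ 2 + b ^ 2) := hsum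
    _ ≤ 2 * Real.sqrt (1 - ⟪ν, m₀⟫_ℝ ^ 2) := by gcongr


/-- **Free form of the single-axis texture rung**: for ANY horizontal `⟨112⟩` direction `w`,
`6·2^{1/3}(√2·Vol)^{2/3} ≤ Fr + (1/√6)·Σ_{τ f ≠ τ g} Σ_{a ∈ s f, b ∈ s g} |⟪w, ν_{ab}⟫|·facetArea`
(the grains' free energy plus the cell wall sum regrouped by grains). -/
theorem rung_singleAxis_texture_free :
    let Λ : Set (EuclideanSpace ℝ (Fin 3)) := Literature.MathematicalPhysics.StatisticalMechanics.fccStacking 1 (Real.sqrt (2 / 3));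
    let Brl : (ℤ → ℤ) → Set (EuclideanSpace ℝ (Fin 3)) := Literature.MathematicalPhysics.StatisticalMechanics.barlowStacking 1 (Real.sqrt (2 / 3));
    let Ax : EuclideanSpace ℝ (Fin 3) → (EuclideanSpace ℝ (Fin 3) ≃ₗᵢ[ℝ] EuclideanSpace ℝ (Fin 3)) → (EuclideanSpace ℝ (Fin 3) ≃ₗᵢ[ℝ] EuclideanSpace ℝ (Fin 3)) → Prop := fun m A B => ∃ (L : EuclideanSpace ℝ (Fin 3) ≃ₗᵢ[ℝ] EuclideanSpace ℝ (Fin 3)) (s₁ s₂ : EuclideanSpace ℝ (Fin 3)) (σ σ' : ℤ → ℤ), Literature.MathematicalPhysics.StatisticalMechanics.IsHaggSeq σ ∧ Literature.MathematicalPhysics.StatisticalMechanics.IsHaggSeq σ' ∧ L (EuclideanSpace.single (2 : Fin 3) (1 : ℝ)) = m ∧ A '' Λ ⊆ (fun q => L q + s₁) '' Brl σ ∧ B '' Λ ⊆ (fun q => L q + s₂) '' Brl σ';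
    let CoAx : (EuclideanSpace ℝ (Fin 3) ≃ₗᵢ[ℝ] EuclideanSpace ℝ (Fin 3)) → (EuclideanSpace ℝ (Fin 3) ≃ₗᵢ[ℝ] EuclideanSpace ℝ (Fin 3)) → Prop := fun A B => ∃ m, Ax m A B;
    let Φ : EuclideanSpace ℝ (Fin 3) → ℝ := fun ν => Real.sqrt 2 / 4 * ∑ᶠ w ∈ {w ∈ Λ | ‖w‖ = 1}, |⟪w, ν⟫_ℝ|;
    let Per : Set (EuclideanSpace ℝ (Fin 3)) → Set (EuclideanSpace ℝ (Fin 3)) → ℝ := fun K S => (⨆ (ξ : EuclideanSpace ℝ (Fin 3) → EuclideanSpace ℝ (Fin 3)) (_ : ContDiff ℝ 1 ξ ∧ HasCompactSupport ξ ∧ ∀ z, ξ z ∈ K), ENNReal.ofReal (∫ z in S, Literature.MathematicalPhysics.StatisticalMechanics.fieldDivergence ξ z)).toReal;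
    let ι : Set (EuclideanSpace ℝ (Fin 3)) → Set (EuclideanSpace ℝ (Fin 3)) → Set (EuclideanSpace ℝ (Fin 3)) → ℝ := fun K S₁ S₂ => (Per K S₁ + Per K S₂ - Per K (S₁ ∪ S₂)) / 2;
    let W : (EuclideanSpace ℝ (Fin 3) ≃ₗᵢ[ℝ] EuclideanSpace ℝ (Fin 3)) → Set (EuclideanSpace ℝ (Fin 3)) := fun A => {y | ∀ ν : EuclideanSpace ℝ (Fin 3), ⟪y, ν⟫_ℝ ≤ Φ (A.symm ν)};
    let Tex : (n : ℕ) → (Fin n → Set (EuclideanSpace ℝ (Fin 3))) → (Fin n → (EuclideanSpace ℝ (Fin 3) ≃ₗᵢ[ℝ] EuclideanSpace ℝ (Fin 3))) → (Fin n → Fin n → ℝ) → (Fin n → Fin n → EuclideanSpace ℝ (Fin 3)) → Prop := fun n G A c m => (∀ f : Fin n, Literature.MathematicalPhysics.StatisticalMechanics.HasFinitePerimeter (G f) ∧ volume (G f) < ⊤) ∧ (∀ f g, f ≠ g → Disjoint (G f) (G g)) ∧ (∀ f g, f ≠ g → 0 ≤ c f g) ∧ (∀ f g, f ≠ g → ¬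 CoAx (A f) (A g) → m f g = 0 ∧ 1 ≤ c f g) ∧ (∀ f g, f ≠ g → CoAx (A f) (A g) → A f '' Λ ≠ A g '' Λ → Ax (m f g) (A f) (A g) ∧ 1 / 2 ≤ c f g);
    let Vol : (n : ℕ) → (Fin n → Set (EuclideanSpace ℝ (Fin 3))) → ℝ := fun n G => (volume (⋃ f : Fin n, G f)).toReal;
    ∀ (k' : ℕ) (Hc : Fin k' → Finset ((EuclideanSpace ℝ (Fin 3)) × ℝ)) (nv : Fin k' → Fin k' → EuclideanSpace ℝ (Fin 3)),
      (∀ j, Bornology.IsBounded (polytope (Hc j))) →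
      (∀ j j', j ≠ j' → Disjoint (polytope (Hc j)) (polytope (Hc j'))) →
      (∀ i j, nv j i = -nv i j) →
      (∀ j j', j ≠ j' → ‖nv j j'‖ = 1 ∧ ∃ b : ℝ,
        closure (polytope (Hc j)) ∩ closure (polytope (Hc j')) ⊆ {x | ⟪nv j j', x⟫_ℝ = b}) →
    ∀ (n : ℕ) (G : Fin n → Set (EuclideanSpace ℝ (Fin 3)))
      (A : Fin n → (EuclideanSpace ℝ (Fin 3) ≃ₗᵢ[ℝ] EuclideanSpace ℝ (Fin 3)))
      (c : Fin n → Fin n → ℝ) (m : Fin n → Fin n → EuclideanSpace ℝ (Fin 3)),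
      Tex n G A c m →
    ∀ (s : Fin n → Finset (Fin k')),
      (∀ f, G f = ⋃ j ∈ s f, polytope (Hc j)) →
      (∀ f g, f ≠ g → Disjoint (s f) (s g)) →
      (∀ j, ∃ f, j ∈ s f) →
    ∀ (τ : Fin n → Bool), (∀ f g, τ f = τ g → A f '' Λ = A g '' Λ) →
    ∀ (m₀ u w : EuclideanSpace ℝ (Fin 3)), (∀ f g, Ax m₀ (A f) (A g)) →
      ‖u‖ = 1 → ‖w‖ = 1 → ⟪u, m₀⟫_ℝ = 0 → ⟪w, m₀⟫_ℝ = 0 → ⟪w, u⟫_ℝ = 0 →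
      (∀ f, u ∈ A f '' Λ) → (∀ f, (ℝ ∙ u)ᗮ.reflection '' (A f '' Λ) = A f '' Λ) →
    6 * (2 : ℝ) ^ ((1 : ℝ) / 3) * (Real.sqrt 2 * Vol n G) ^ ((2 : ℝ) / 3) ≤
      (∑ f, Per (W (A f)) (G f) - ∑ f, ∑ g, (if f = g then 0 else ι (W (A f)) (G f) (G g))) +
        1 / Real.sqrt 6 * ∑ f, ∑ g, (if τ f = τ g then 0 else ∑ a ∈ s f, ∑ b ∈ s g,
          |⟪w, nv a b⟫_ℝ| * facetArea (closure (polytope (Hc a)) ∩ closure (polytope (Hc b))) (nv a b)) := by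
  intro Λ Brl Ax CoAx Φ Per ι W Tex Vol k' Hc nv hbd hdisjQ hanti hplane n G A c m hTex
    s hGs hsdisj hcov τ hτ1 m₀ u w hAx hu hw hum hwm hwu hbond hmir
  classical
  obtain ⟨hfin, hdisjG, -, -, -⟩ := hTex
  have hvol : ∀ f, volume (G f) < ⊤ := fun f => (hfin f).2
  rcases Nat.eq_zero_or_pos n with hn | hn
  · subst hn
    show 6 * (2 : ℝ) ^ ((1 : ℝ) / 3) * (Real.sqrt 2 * (volume (⋃ f : Fin 0, G f)).toReal) ^ ((2 : ℝ) / 3) ≤ _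
    rw [iUnion_of_empty, measure_empty, ENNReal.toReal_zero, mul_zero, Real.zero_rpow (by norm_num),
      mul_zero]
    simp
  have hm₀ : ‖m₀‖ = 1 := by
    obtain ⟨L, -, -, -, -, -, -, hLm, -, -⟩ := hAx ⟨0, hn⟩ ⟨0, hn⟩
    rw [← hLm, LinearIsometryEquiv.norm_map, PiLp.norm_single, norm_one]
  -- cells, their grains
  set Q : Fin k' → Set E3 := fun j => polytope (Hc j) with hQ
  choose gr hgr using hcov
  have hgr_eq : ∀ j f, j ∈ s f → gr j = f := by
    intro j f hj
    by_contra h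
    exact Finset.disjoint_left.1 (hsdisj _ _ h) (hgr j) hj
  have hfilter : ∀ f, Finset.univ.filter (fun j => gr j = f) = s f := by
    intro f; ext j
    simp only [Finset.mem_filter, Finset.mem_univ, true_and]
    exact ⟨fun h => h ▸ hgr j, fun h => hgr_eq j f h⟩
  have hQpoly : ∀ j, ∃ (k : ℕ) (H' : Fin k → Finset (E3 × ℝ)), Q j = ⋃ i, polytope (H' i) :=
    fun j => ⟨1, fun _ => Hc j, by ext x; simp [hQ]⟩
  have hQvol : ∀ j, volume (Q j) < ⊤ := fun j => (hbd j).measure_lt_top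
  -- the cell rung
  set fa : Fin k' → Fin k' → ℝ := fun a b =>
    facetArea (closure (polytope (Hc a)) ∩ closure (polytope (Hc b))) (nv a b) with hfa
  have hfa0 : ∀ a b, 0 ≤ fa a b := fun a b => ENNReal.toReal_nonneg
  have hR := rung_singleAxis_cells k' Hc (fun j => A (gr j)) nv (fun j => τ (gr j)) m₀ u w hbd hdisjQ
    hanti hplane (fun j j' => hAx (gr j) (gr j'))
    (fun j j' h => wulffBody_eq_of_image_eq (hτ1 _ _ h)) hu hw hum hwm hwu (fun j => hbond (gr j))
    (fun j => hmir (gr j))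
  -- (i) volumes agree
  have hUnion : (⋃ j, ⋂ p ∈ Hc j, {x : E3 | ⟪p.1, x⟫_ℝ < p.2}) = ⋃ f, G f := by
    apply subset_antisymm
    · intro x hx
      obtain ⟨j, hj⟩ := mem_iUnion.1 hx
      refine mem_iUnion.2 ⟨gr j, ?_⟩
      rw [hGs]
      exact mem_biUnion (hgr j) hj
    · intro x hx
      obtain ⟨f, hf⟩ := mem_iUnion.1 hx
      rw [hGs] at hf
      obtain ⟨j, -, hj⟩ := mem_iUnion₂.1 hf
      exact mem_iUnion.2 ⟨j, hj⟩
  -- (ii) free energies agree: merge the cells of each grain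
  have hWc : ∀ f, IsCompact (W (A f)) := fun f => isCompact_cruxWulffBody (A f)
  have hWv : ∀ f, Convex ℝ (W (A f)) := fun f => convex_cruxWulffBody (A f)
  have hW0 : ∀ f, (0 : E3) ∈ W (A f) := fun f => zero_mem_cruxWulffBody (A f)
  have hWs : ∀ f, -W (A f) = W (A f) := fun f => neg_cruxWulffBody_eq (A f)
  have hmerge := freeEnergy_eq_merged_texture Q hQpoly hQvol hdisjQ gr Finset.univ
    (fun j => Finset.mem_univ _) (fun f => W (A f)) hWc hWv hW0 hWs
  have hUf : ∀ f, (⋃ j ∈ Finset.univ.filter (fun j => gr j = f), Q j) = G f := by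
    intro f; rw [hfilter, hGs]
  simp only [hUf] at hmerge
  have hFr : (∑ j, Per (W (A (gr j))) (⋂ p ∈ Hc j, {x : E3 | ⟪p.1, x⟫_ℝ < p.2}) -
      ∑ j, ∑ j', (if j = j' then 0 else ι (W (A (gr j))) (⋂ p ∈ Hc j, {x : E3 | ⟪p.1, x⟫_ℝ < p.2})
        (⋂ p ∈ Hc j', {x : E3 | ⟪p.1, x⟫_ℝ < p.2}))) =
      ∑ f, Per (W (A f)) (G f) - ∑ f, ∑ g, (if f = g then 0 else ι (W (A f)) (G f) (G g)) := by
    rw [← Finset.sum_sub_distrib, ← Finset.sum_sub_distrib]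
    exact hmerge
  -- (iii) the cell wall sum regrouped by grains
  set t : Fin k' → Fin k' → ℝ := fun a b => |⟪w, nv a b⟫_ℝ| * fa a b with ht
  have hregroup : (∑ j, ∑ j', (if τ (gr j) = τ (gr j') then 0 else t j j')) =
      ∑ f, ∑ g, (if τ f = τ g then 0 else ∑ a ∈ s f, ∑ b ∈ s g, t a b) := by
    have hmaps : ∀ j ∈ (Finset.univ : Finset (Fin k')), gr j ∈ (Finset.univ : Finset (Fin n)) :=
      fun j _ => Finset.mem_univ _
    rw [← Finset.sum_fiberwise_of_maps_to hmaps]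
    refine Finset.sum_congr rfl fun f _ => ?_
    rw [hfilter]
    have hinner : ∀ a ∈ s f, (∑ j', (if τ (gr a) = τ (gr j') then 0 else t a j')) =
        ∑ g, (if τ f = τ g then 0 else ∑ b ∈ s g, t a b) := by
      intro a ha
      rw [hgr_eq a f ha, ← Finset.sum_fiberwise_of_maps_to hmaps]
      refine Finset.sum_congr rfl fun g _ => ?_
      rw [hfilter]
      by_cases hfg : τ f = τ g
      · rw [if_pos hfg]
        refine Finset.sum_eq_zero fun b hb => ?_
        rw [hgr_eq b g hb, if_pos hfg]
      · rw [if_neg hfg]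
        refine Finset.sum_congr rfl fun b hb => ?_
        rw [hgr_eq b g hb, if_neg hfg]
    rw [Finset.sum_congr rfl hinner, Finset.sum_comm]
    refine Finset.sum_congr rfl fun g _ => ?_
    by_cases hfg : τ f = τ g
    · simp only [if_pos hfg, Finset.sum_const_zero]
    · simp only [if_neg hfg]
  show 6 * (2 : ℝ) ^ ((1 : ℝ) / 3) * (Real.sqrt 2 * (volume (⋃ f, G f)).toReal) ^ ((2 : ℝ) / 3) ≤
    (∑ f, Per (W (A f)) (G f) - ∑ f, ∑ g, (if f = g then 0 else ι (W (A f)) (G f) (G g))) +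
      1 / Real.sqrt 6 * ∑ f, ∑ g, (if τ f = τ g then 0 else ∑ a ∈ s f, ∑ b ∈ s g, t a b)
  rw [← hregroup]
  refine le_trans (le_of_eq ?_) (le_trans hR (le_of_eq ?_))
  · show _ = 6 * (2 : ℝ) ^ ((1 : ℝ) / 3) *
      (Real.sqrt 2 * (volume (⋃ j, ⋂ p ∈ Hc j, {x : E3 | ⟪p.1, x⟫_ℝ < p.2})).toReal) ^ ((2 : ℝ) / 3)
    rw [hUnion]
  · show (∑ j, Per (W (A (gr j))) (⋂ p ∈ Hc j, {x : E3 | ⟪p.1, x⟫_ℝ < p.2}) -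
        ∑ j, ∑ j', (if j = j' then 0 else ι (W (A (gr j))) (⋂ p ∈ Hc j, {x : E3 | ⟪p.1, x⟫_ℝ < p.2})
          (⋂ p ∈ Hc j', {x : E3 | ⟪p.1, x⟫_ℝ < p.2}))) +
        1 / Real.sqrt 6 * ∑ j, ∑ j', (if τ (gr j) = τ (gr j') then 0 else t j j') = _
    rw [hFr]


end Summit.Ventures.Crystal3D.Cruxes.PolycrystalWulffBound.PolyDensity

end
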